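import Literature.MathematicalPhysics.QuantumFieldTheory.Balaban1983to89.B4ContourShift

/-!
# `BalabanUV.Beta.FP.FourierSliceIBP` — road «FP» for binder row D1, leaf H2-P-KER of the H′-route (owner ruling R-FP-17 (c),
# `HOME/b2b-balaban-beta-d1-p3/OWNER-RULINGS-FP-5.md`): POWER-LAW DECAY OF A LATTICE KERNEL FROM INTEGRABLE SLICE DERIVATIVES OF ITS SYMBOL —
# iterated one-dimensional integration by parts on the Brillouin zone (row H2-P-IBP)

HONEST DEPENDENCY (page 1, mandatory): continuum YM on T⁴ ⇐ BetaPertH ∧ nine spine estimates (0/9 proved); BetaPertH ⇐ (D1) ∧ (D4) ∧ CAP+tail;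
G-an2-4 gates asym, D1 and NE2/3/4.  HONEST FRAMING (cell contract, verbatim): «discharging `BetaPertH` makes Bałaban's UV stability UNCONDITIONAL —
a real constructive-QFT result; it is NOT the continuum limit and NOT the Clay problem.»  THIS MODULE DISCHARGES NOTHING of the wall: it is [folklore]
Fourier analysis on the torus `[-π,π]^{d+1}` (Mathlib + the tree's `B4ContourShift` box integral `fourierBox`, its Fubini lemma `fourierBox_eq_iterated` and
the sup norm `supNorm`), about ARBITRARY symbols `G`; no road object, no `def`, no `def … : Prop`, no cited fact, 0 sorry; 0 wall binders; NOT D1, NOT BetaPertH,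
NOT continuum, NOT Clay.

ABSOLUTE RULE (cell charter, verbatim): «No internally-minted statement may enter as a cited fact. Every hypothesis is either kernel-proved in this package or a
verbatim quotation of a PUBLISHED theorem with page reference. The manuscript(s) under audit are NOT citable for their own disputed steps — they are the thing
under adjudication; programme-internal (2001/route/tribunal) claims are never citable.»

WHY (R-FP-17 (c)).  The unconstrained perfect propagator symbol `PinfSym = |p̂|⁻²·𝟙 + B` (`FP/PerfectPropagatorSymbol`) has a remainder `B` that is BOUNDED but
NOT continuous at `p = 0`; its lattice kernel is NOT summable-with-exponential-tails (`B4ContourShift.latticeKernel_decay` needs strip holomorphy).  What the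
germ of the one-loop polarization needs is only a POWER gain: `|K_B(z)| ≤ C‖z‖∞⁻³`, `|∇K_B| ≤ C‖z‖∞⁻⁴`, … .  In `d + 1 = 4` dimensions `|s|⁻³ ∈ L¹` on the zone, so THREE
integrations by parts in ONE coordinate suffice, provided the slice derivatives `∂_iᵏB` obey `‖∂_iᵏB(s)‖ ≤ C|s|^{−k}` (rows H2-P-INV/REG/B) — no dyadic decomposition,
no degree-0 homogeneous expansion.  This file is the abstract integration-by-parts engine.

WHAT.  §1 `intervalIntegral_mul_cexp_eq` — ONE VARIABLE: for `u : ℝ → ℂ` with `HasDerivAt u (u′ t) t` everywhere, `u′` continuous, `u (−π) = u π`, and an integer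
`n ≠ 0`: `∫_{−π}^{π} u(t)·e^{itn} dt = (i/n)·∫_{−π}^{π} u′(t)·e^{itn} dt` (Mathlib `intervalIntegral.integral_mul_deriv_eq_deriv_mul`; the boundary term dies because
`e^{iπn} = e^{−iπn}`).  §2 `fourierBox_eq_of_slice_hasDerivAt` — THE SLICE IDENTITY on `[-π,π]^{d+1}`: if for a.e. `q ∈ [-π,π]^d` the slice `t ↦ G(i.insertNth t q)`
has derivative the slice of `G′`, continuous, with equal values at `t = ∓π`, and both box integrands are integrable, then `fourierBox G x = (i / x_i)·fourierBox G′ x`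
for `x_i ≠ 0` (`B4ContourShift.fourierBox_eq_iterated` + §1 slice by slice).  §3 `norm_fourierBox_le_integral_norm` (`‖fourierBox G x‖ ≤ ∫_{BZ} ‖G‖`) and the one-step
bound `norm_fourierBox_le_of_slice_hasDerivAt`.  §4 ITERATION `fourierBox_eq_of_slice_derivs` (`= (i/x_i)ᵏ·fourierBox G_k x` for a chain `G₀, G₁, …, G_k` of slice
derivatives) and **`norm_fourierBox_le_of_slice_derivs`**: `‖fourierBox G₀ x‖ ≤ |x_i|^{−k}·∫_{BZ} ‖G_k‖`.  §5 ALL DIRECTIONS: **`norm_fourierBox_mul_supNorm_pow_le`** /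
`norm_latticeKernel_mul_supNorm_pow_le` — with a chain in EVERY coordinate direction and a common `L¹` bound `M` on the k-th derivatives, `‖fourierBox G₀ x‖·‖x‖∞ᵏ ≤ M`
(`‖latticeKernel G₀ x‖·‖x‖∞ᵏ ≤ M/(2π)^{d+1}`) for `x ≠ 0`.
Provenance: road FP owner b2b-balaban-beta-d1-p3 gen 5 (prover-b2b-balaban-beta-d1-p3-g5-0), 2026-08-20.  [folklore], 0 def, 0 cite, 0 sorry.
-/

noncomputable section

namespace Summit.QuantumFields.BalabanUV.Beta.FP.FourierSliceIBP

open MeasureTheory Set Complex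
open scoped Real
open Literature.MathematicalPhysics.QuantumFieldTheory.Balaban1983to89
open B4Strip (ofRealVec)
open B4ContourShift (BZ phase integrand fourierBox latticeKernel fourierBox_eq_iterated phase_insertNth norm_cexp_phase supNorm
  exists_supNorm_eq abs_le_supNorm supNorm_nonneg)

variable {d : ℕ}

/-! ## §1 One variable: integration by parts against a character over one period -/

/-- [folklore] The character `t ↦ e^{itn}/(in)` has derivative `e^{itn}` (`n ≠ 0`). -/
theorem hasDerivAt_cexp_div (n : ℤ) (hn : n ≠ 0) (t : ℝ) :
    HasDerivAt (fun t : ℝ => cexp (I * ((t : ℂ) * (n : ℂ))) / (I * (n : ℂ))) (cexp (I * ((t : ℂ) * (n : ℂ)))) t := by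
  have hIn : (I * (n : ℂ)) ≠ 0 := mul_ne_zero I_ne_zero (by exact_mod_cast hn)
  have h1 : HasDerivAt (fun t : ℝ => I * ((t : ℂ) * (n : ℂ))) (I * (n : ℂ)) t := by
    have h := ((hasDerivAt_id t).ofReal_comp.mul_const (n : ℂ)).const_mul I
    simpa using h
  have h2 := ((Complex.hasDerivAt_exp (I * ((t : ℂ) * (n : ℂ)))).comp t h1).div_const (I * (n : ℂ))
  have h3 : cexp (I * ((t : ℂ) * (n : ℂ))) * (I * (n : ℂ)) / (I * (n : ℂ)) = cexp (I * ((t : ℂ) * (n : ℂ))) := by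
    rw [mul_div_assoc, div_self hIn, mul_one]
  rw [h3] at h2
  simpa [Function.comp_def] using h2

/-- [folklore] `e^{iπn} = e^{−iπn}` for an integer `n`. -/
theorem cexp_pi_eq_cexp_neg_pi (n : ℤ) :
    cexp (I * (((π : ℝ) : ℂ) * (n : ℂ))) = cexp (I * ((((-π : ℝ)) : ℂ) * (n : ℂ))) := by
  refine Complex.exp_eq_exp_iff_exists_int.mpr ⟨n, ?_⟩
  push_cast
  ring

/-- [folklore] **INTEGRATION BY PARTS AGAINST A CHARACTER OVER ONE PERIOD**: for `u : ℝ → ℂ` differentiable everywhere with continuous derivative `u′` and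
`u (−π) = u π`, and an integer `n ≠ 0`, `∫_{−π}^{π} u(t) e^{itn} dt = (i/n) ∫_{−π}^{π} u′(t) e^{itn} dt` (no boundary term). -/
theorem intervalIntegral_mul_cexp_eq {u u' : ℝ → ℂ} {n : ℤ} (hn : n ≠ 0)
    (hu : ∀ t, HasDerivAt u (u' t) t) (hu' : Continuous u') (hper : u (-π) = u π) :
    ∫ t in (-π)..π, u t * cexp (I * ((t : ℂ) * (n : ℂ)))
      = (I / (n : ℂ)) * ∫ t in (-π)..π, u' t * cexp (I * ((t : ℂ) * (n : ℂ))) := by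
  have hnC : (n : ℂ) ≠ 0 := by exact_mod_cast hn
  have hIn : (I * (n : ℂ)) ≠ 0 := mul_ne_zero I_ne_zero hnC
  set v : ℝ → ℂ := fun t => cexp (I * ((t : ℂ) * (n : ℂ))) / (I * (n : ℂ)) with hv
  have hvd : ∀ t ∈ uIcc (-π) π, HasDerivAt v (cexp (I * ((t : ℂ) * (n : ℂ)))) t :=
    fun t _ => hasDerivAt_cexp_div n hn t
  have hud : ∀ t ∈ uIcc (-π) π, HasDerivAt u (u' t) t := fun t _ => hu t
  have hcexp : Continuous (fun t : ℝ => cexp (I * ((t : ℂ) * (n : ℂ)))) := by fun_prop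
  have hparts := intervalIntegral.integral_mul_deriv_eq_deriv_mul hud hvd (hu'.intervalIntegrable _ _)
    (hcexp.intervalIntegrable _ _)
  -- the boundary term vanishes
  have hvπ : v π = v (-π) := by
    simp only [hv]; rw [cexp_pi_eq_cexp_neg_pi n]
  have hbd : u π * v π - u (-π) * v (-π) = 0 := by rw [hper, hvπ]; ring
  rw [hparts, hbd, zero_sub]
  -- `−∫ u′ v = (i/n) ∫ u′ e^{itn}`
  have hI : ∀ t, u' t * v t = (u' t * cexp (I * ((t : ℂ) * (n : ℂ)))) * (I * (n : ℂ))⁻¹ := by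
    intro t; simp only [hv]; rw [div_eq_mul_inv, mul_assoc]
  simp_rw [hI, intervalIntegral.integral_mul_const]
  rw [mul_comm (I / (n : ℂ)), ← mul_neg]
  congr 1
  rw [mul_inv, Complex.inv_I]
  field_simp

/-! ## §2 The slice identity on the box `[-π,π]^{d+1}` -/

/-- [folklore] The inner (one-coordinate) integral of the box integrand along the slice through `q` in direction `i`, as an interval integral against the
character of `x_i`, times the unimodular phase of the remaining coordinates. -/
theorem inner_integral_eq (F : (Fin (d + 1) → ℂ) → ℂ) (x : Fin (d + 1) → ℤ) (i : Fin (d + 1)) (q : Fin d → ℝ) :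
    (∫ t in Icc (-π) π, integrand F x (i.insertNth t q))
      = (∫ t in (-π)..π, F (ofRealVec (i.insertNth t q)) * cexp (I * ((t : ℂ) * (x i : ℂ))))
          * cexp (I * phase q (fun j => x (i.succAbove j))) := by
  rw [intervalIntegral.integral_of_le (by linarith [Real.pi_pos] : -π ≤ π), integral_Icc_eq_integral_Ioc,
    ← integral_mul_const]
  refine setIntegral_congr_fun measurableSet_Ioc fun t _ => ?_
  simp only [integrand, phase_insertNth, mul_add, Complex.exp_add]
  ring

/-- [folklore] **THE SLICE IDENTITY.**  Let `G G′` be symbols on `ℂ^{d+1}`, `i` a coordinate and `x ∈ ℤ^{d+1}` with `x_i ≠ 0`.  If both box integrands are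
integrable on `[-π,π]^{d+1}` and, for a.e. `q ∈ [-π,π]^d`, the real slice `t ↦ G(i.insertNth t q)` has derivative the slice of `G′` at every `t`, that slice of `G′`
is continuous, and `G` takes equal values at the two ends `t = ∓π` of the slice, then `fourierBox G x = (i/x_i)·fourierBox G′ x`. -/
theorem fourierBox_eq_of_slice_hasDerivAt (G G' : (Fin (d + 1) → ℂ) → ℂ) (i : Fin (d + 1)) (x : Fin (d + 1) → ℤ) (hx : x i ≠ 0)
    (hint : IntegrableOn (integrand G x) (BZ (d + 1))) (hint' : IntegrableOn (integrand G' x) (BZ (d + 1)))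
    (hslice : ∀ᵐ q ∂(volume.restrict (BZ d)),
      (∀ t : ℝ, HasDerivAt (fun t : ℝ => G (ofRealVec (i.insertNth t q))) (G' (ofRealVec (i.insertNth t q))) t) ∧
      Continuous (fun t : ℝ => G' (ofRealVec (i.insertNth t q))) ∧
      G (ofRealVec (i.insertNth (-π) q)) = G (ofRealVec (i.insertNth π q))) :
    fourierBox G x = (I / (x i : ℂ)) * fourierBox G' x := by
  rw [fourierBox_eq_iterated G x i hint, fourierBox_eq_iterated G' x i hint', ← integral_const_mul]
  refine integral_congr_ae ?_
  filter_upwards [hslice] with q hq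
  obtain ⟨hder, hcont, hper⟩ := hq
  rw [inner_integral_eq G x i q, inner_integral_eq G' x i q,
    intervalIntegral_mul_cexp_eq (u := fun t : ℝ => G (ofRealVec (i.insertNth t q))) hx hder hcont hper]
  ring

/-! ## §3 Norm bounds -/

/-- [folklore] `‖fourierBox G x‖ ≤ ∫_{[-π,π]^{n}} ‖G(p)‖ dp` (the character is unimodular). -/
theorem norm_fourierBox_le_integral_norm {n : ℕ} (G : (Fin n → ℂ) → ℂ) (x : Fin n → ℤ) :
    ‖fourierBox G x‖ ≤ ∫ p in BZ n, ‖G (ofRealVec p)‖ := by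
  unfold fourierBox
  refine (norm_integral_le_integral_norm _).trans (le_of_eq ?_)
  refine setIntegral_congr_fun (by unfold BZ; exact measurableSet_Icc) fun p _ => ?_
  simp only [integrand, norm_mul, norm_cexp_phase, mul_one]

/-- [folklore] `‖i / x_i‖ = 1/|x_i|`. -/
theorem norm_I_div_intCast (m : ℤ) : ‖I / (m : ℂ)‖ = 1 / |(m : ℝ)| := by
  rw [norm_div, Complex.norm_I, Complex.norm_intCast]

/-- [folklore] ONE STEP: under the hypotheses of the slice identity, `‖fourierBox G x‖ ≤ |x_i|⁻¹ · ∫_{BZ} ‖G′‖`. -/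
theorem norm_fourierBox_le_of_slice_hasDerivAt (G G' : (Fin (d + 1) → ℂ) → ℂ) (i : Fin (d + 1)) (x : Fin (d + 1) → ℤ)
    (hx : x i ≠ 0) (hint : IntegrableOn (integrand G x) (BZ (d + 1))) (hint' : IntegrableOn (integrand G' x) (BZ (d + 1)))
    (hslice : ∀ᵐ q ∂(volume.restrict (BZ d)),
      (∀ t : ℝ, HasDerivAt (fun t : ℝ => G (ofRealVec (i.insertNth t q))) (G' (ofRealVec (i.insertNth t q))) t) ∧
      Continuous (fun t : ℝ => G' (ofRealVec (i.insertNth t q))) ∧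
      G (ofRealVec (i.insertNth (-π) q)) = G (ofRealVec (i.insertNth π q))) :
    ‖fourierBox G x‖ ≤ (∫ p in BZ (d + 1), ‖G' (ofRealVec p)‖) / |(x i : ℝ)| := by
  rw [fourierBox_eq_of_slice_hasDerivAt G G' i x hx hint hint' hslice, norm_mul, norm_I_div_intCast, mul_comm,
    ← div_eq_mul_one_div]
  have hpos : 0 < |(x i : ℝ)| := abs_pos.mpr (by exact_mod_cast hx)
  exact div_le_div_of_nonneg_right (norm_fourierBox_le_integral_norm G' x) hpos.le

/-! ## §4 Iteration: `k` integrations by parts in one direction -/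

/-- [folklore] **ITERATED SLICE IDENTITY.**  For a chain `G 0, G 1, …, G k` of symbols in which, for every `j < k` and a.e. `q`, the slice of `G (j+1)` in direction
`i` is the (continuous) derivative of the slice of `G j` and `G j` matches at the slice ends, all box integrands integrable:
`fourierBox (G 0) x = (i/x_i)ᵏ · fourierBox (G k) x`. -/
theorem fourierBox_eq_of_slice_derivs (G : ℕ → (Fin (d + 1) → ℂ) → ℂ) (i : Fin (d + 1)) (x : Fin (d + 1) → ℤ) (hx : x i ≠ 0) (k : ℕ)
    (hint : ∀ j ≤ k, IntegrableOn (integrand (G j) x) (BZ (d + 1)))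
    (hslice : ∀ j < k, ∀ᵐ q ∂(volume.restrict (BZ d)),
      (∀ t : ℝ, HasDerivAt (fun t : ℝ => G j (ofRealVec (i.insertNth t q))) (G (j + 1) (ofRealVec (i.insertNth t q))) t) ∧
      Continuous (fun t : ℝ => G (j + 1) (ofRealVec (i.insertNth t q))) ∧
      G j (ofRealVec (i.insertNth (-π) q)) = G j (ofRealVec (i.insertNth π q))) :
    fourierBox (G 0) x = (I / (x i : ℂ)) ^ k * fourierBox (G k) x := by
  induction k with
  | zero => simp
  | succ k ih =>
    have h := ih (fun j hj => hint j (by omega)) (fun j hj => hslice j (by omega))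
    rw [h, fourierBox_eq_of_slice_hasDerivAt (G k) (G (k + 1)) i x hx (hint k (by omega)) (hint (k + 1) le_rfl)
      (hslice k (by omega))]
    ring

/-- [folklore] **THE k-FOLD BOUND**: under the hypotheses of `fourierBox_eq_of_slice_derivs`,
`‖fourierBox (G 0) x‖ ≤ |x_i|^{−k} · ∫_{[-π,π]^{d+1}} ‖G k‖`. -/
theorem norm_fourierBox_le_of_slice_derivs (G : ℕ → (Fin (d + 1) → ℂ) → ℂ) (i : Fin (d + 1)) (x : Fin (d + 1) → ℤ) (hx : x i ≠ 0) (k : ℕ)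
    (hint : ∀ j ≤ k, IntegrableOn (integrand (G j) x) (BZ (d + 1)))
    (hslice : ∀ j < k, ∀ᵐ q ∂(volume.restrict (BZ d)),
      (∀ t : ℝ, HasDerivAt (fun t : ℝ => G j (ofRealVec (i.insertNth t q))) (G (j + 1) (ofRealVec (i.insertNth t q))) t) ∧
      Continuous (fun t : ℝ => G (j + 1) (ofRealVec (i.insertNth t q))) ∧
      G j (ofRealVec (i.insertNth (-π) q)) = G j (ofRealVec (i.insertNth π q))) :
    ‖fourierBox (G 0) x‖ ≤ (∫ p in BZ (d + 1), ‖G k (ofRealVec p)‖) / |(x i : ℝ)| ^ k := by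
  rw [fourierBox_eq_of_slice_derivs G i x hx k hint hslice, norm_mul, norm_pow, norm_I_div_intCast, one_div, inv_pow,
    mul_comm, ← div_eq_mul_inv]
  have hpos : 0 < |(x i : ℝ)| ^ k := pow_pos (abs_pos.mpr (by exact_mod_cast hx)) k
  exact div_le_div_of_nonneg_right (norm_fourierBox_le_integral_norm (G k) x) hpos.le

/-! ## §5 All directions: decay in the sup norm -/

/-- [folklore] A nonzero lattice vector has a coordinate realising its (positive) sup norm. -/
theorem exists_supNorm_eq_of_ne_zero {x : Fin (d + 1) → ℤ} (hx : x ≠ 0) :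
    ∃ i, supNorm x = ((|x i| : ℤ) : ℝ) ∧ x i ≠ 0 := by
  obtain ⟨i, hi⟩ := exists_supNorm_eq x
  refine ⟨i, hi, fun h0 => hx ?_⟩
  funext j
  have hj := abs_le_supNorm x j
  rw [hi, h0, abs_zero, Int.cast_zero] at hj
  have : |x j| ≤ 0 := by exact_mod_cast hj
  exact abs_nonpos_iff.mp this

/-- [folklore] **DECAY IN THE SUP NORM.**  Suppose that in EVERY coordinate direction `i` there is a chain `G i 0 = G₀, G i 1, …, G i k` of slice derivatives as
in `fourierBox_eq_of_slice_derivs`, and a common bound `∫_{BZ} ‖G i k‖ ≤ M`.  Then `‖fourierBox G₀ x‖ · ‖x‖∞ᵏ ≤ M` for every `x ≠ 0`. -/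
theorem norm_fourierBox_mul_supNorm_pow_le (G₀ : (Fin (d + 1) → ℂ) → ℂ) (G : Fin (d + 1) → ℕ → (Fin (d + 1) → ℂ) → ℂ) (k : ℕ) (M : ℝ)
    (x : Fin (d + 1) → ℤ) (hx : x ≠ 0) (h0 : ∀ i, G i 0 = G₀)
    (hint : ∀ i, ∀ j ≤ k, IntegrableOn (integrand (G i j) x) (BZ (d + 1)))
    (hslice : ∀ i, ∀ j < k, ∀ᵐ q ∂(volume.restrict (BZ d)),
      (∀ t : ℝ, HasDerivAt (fun t : ℝ => G i j (ofRealVec (i.insertNth t q))) (G i (j + 1) (ofRealVec (i.insertNth t q))) t) ∧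
      Continuous (fun t : ℝ => G i (j + 1) (ofRealVec (i.insertNth t q))) ∧
      G i j (ofRealVec (i.insertNth (-π) q)) = G i j (ofRealVec (i.insertNth π q)))
    (hM : ∀ i, (∫ p in BZ (d + 1), ‖G i k (ofRealVec p)‖) ≤ M) :
    ‖fourierBox G₀ x‖ * supNorm x ^ k ≤ M := by
  obtain ⟨i, hi, hxi⟩ := exists_supNorm_eq_of_ne_zero hx
  have h := norm_fourierBox_le_of_slice_derivs (G i) i x hxi k (hint i) (hslice i)
  rw [h0 i] at h
  have hpos : 0 < |(x i : ℝ)| ^ k := pow_pos (abs_pos.mpr (by exact_mod_cast hxi)) k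
  have hcast : supNorm x = |(x i : ℝ)| := by rw [hi, Int.cast_abs]
  rw [hcast]
  calc ‖fourierBox G₀ x‖ * |(x i : ℝ)| ^ k
      ≤ (∫ p in BZ (d + 1), ‖G i k (ofRealVec p)‖) / |(x i : ℝ)| ^ k * |(x i : ℝ)| ^ k :=
        mul_le_mul_of_nonneg_right h hpos.le
    _ = ∫ p in BZ (d + 1), ‖G i k (ofRealVec p)‖ := div_mul_cancel₀ _ hpos.ne'
    _ ≤ M := hM i

/-- [folklore] The same for the normalised lattice kernel: `‖latticeKernel G₀ x‖ · ‖x‖∞ᵏ ≤ M/(2π)^{d+1}`. -/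
theorem norm_latticeKernel_mul_supNorm_pow_le (G₀ : (Fin (d + 1) → ℂ) → ℂ) (G : Fin (d + 1) → ℕ → (Fin (d + 1) → ℂ) → ℂ) (k : ℕ) (M : ℝ)
    (x : Fin (d + 1) → ℤ) (hx : x ≠ 0) (h0 : ∀ i, G i 0 = G₀)
    (hint : ∀ i, ∀ j ≤ k, IntegrableOn (integrand (G i j) x) (BZ (d + 1)))
    (hslice : ∀ i, ∀ j < k, ∀ᵐ q ∂(volume.restrict (BZ d)),
      (∀ t : ℝ, HasDerivAt (fun t : ℝ => G i j (ofRealVec (i.insertNth t q))) (G i (j + 1) (ofRealVec (i.insertNth t q))) t) ∧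
      Continuous (fun t : ℝ => G i (j + 1) (ofRealVec (i.insertNth t q))) ∧
      G i j (ofRealVec (i.insertNth (-π) q)) = G i j (ofRealVec (i.insertNth π q)))
    (hM : ∀ i, (∫ p in BZ (d + 1), ‖G i k (ofRealVec p)‖) ≤ M) :
    ‖latticeKernel G₀ x‖ * supNorm x ^ k ≤ M / (2 * π) ^ (d + 1) := by
  have h := norm_fourierBox_mul_supNorm_pow_le G₀ G k M x hx h0 hint hslice hM
  have hpos : (0 : ℝ) < (2 * π) ^ (d + 1) := by positivity
  unfold latticeKernel
  rw [norm_smul, Real.norm_eq_abs, abs_of_pos (inv_pos.mpr hpos), mul_assoc, le_div_iff₀ hpos]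
  calc ((2 * π) ^ (d + 1))⁻¹ * (‖fourierBox G₀ x‖ * supNorm x ^ k) * (2 * π) ^ (d + 1)
      = ‖fourierBox G₀ x‖ * supNorm x ^ k := by field_simp
    _ ≤ M := h

end Summit.QuantumFields.BalabanUV.Beta.FP.FourierSliceIBP

end
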